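import Mathlib
import Summits.PneNP.PneNP.Theorems.NegLimitedSparseLadderTradeoff
import Summits.PneNP.PneNP.Theorems.NegLimitedLadderRecurringCliqueSlices
import HarnessLib

/-!
# Route NegLimited — line `sparse-ladder`, stub `stub_inverseLinearAssembly` (rung F-N1/p3, ROUND-10)

Registered stub of the skeleton `sparse-ladder` on the rung item
`NegLimited.NeglimitedInverseLinearNegations` (stmt-PneNP-19681; HOME/pnp-ideate-p3/r10/sparse-ladder.lean,
sha dee521b8906a2977): `TradeoffGivesRung := NeglimitedCliqueSparseTradeoff → NeglimitedInverseLinearNegations`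
— the engine-level trade-off (R10-A, LANDED: `neglimitedCliqueSparseTradeoff_holds`,
Theorems/NegLimitedSparseLadderTradeoff.lean) gives the language-level rung R10-B — and, composing, the rung
**`NegLimitedSparseLadder.neglimitedInverseLinearNegations_holds : NeglimitedInverseLinearNegations`**
PROVED against the verbatim local copy of the item signature.

The language is the recurring padded clique language `recCliqueLang ∈ NP` of line `density-ladder`
(Theorems/NegLimitedLadderRecurringCliqueSlices.lean): its slice at length `m·m + k` (`k < m`) is
`CLIQUE(m, k)` of the square part.  Given `c`, take `c' = 2c+1`, `k = 8c'+17 = 16c+25` and the lengths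
`n = m·m + k` for all large `m`: the trade-off at `c'` says that De Morgan circuits for `CLIQUE(m,k)` with
`≤ ⌊log₂ m⌋/(16c+26)` NOT gates have `≥ m^{2c+1} ≥ n^c + 1` gates (`(m²+k)^c + 1 ≤ m^{2c+1}` once
`m ≥ 2^c`, `m ≥ 2`), the budget `⌊log₂ n⌋/(48c+78)` is at most `⌊log₂ m⌋/(16c+26)`
(`⌊log₂(m²+k)⌋ ≤ 2⌊log₂ m⌋ + 1`), and the exact-length transfer
`le_negLimitedSizeOver_sliceFn_recClique` (pure variable retraction) carries the bound to the slice.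

Honest scope (cell record HOME/pnp-ideate-p3/r10/sparse-ladder.md): the INVERSE-LINEAR rate — for every `c`,
`⌊log₂ n⌋/(48c+78)` negations force size `> n^c` infinitely often, ONE language for all `c`; this implies
R9-B (`(log n)/w(n)` for every `w → ∞`, stmt-PneNP-19555) and is NOT the door stmt-PneNP-19860
(`ε log n` for ONE `ε` and all `c`).  A restricted-model lower bound; nothing here bears on P vs NP.
-/

set_option linter.dupNamespace false -- `Summit.PneNP.PneNP.…`: summit = sub-problem name (D-0017 single-conjunct layout)

noncomputable section

namespace Summit.PneNP.PneNP.Theorems.NegLimitedSparseLadder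

open Finset Filter
open Literature.Computability.Complexity
open Summit.PneNP.PneNP.Theorems.NegLimitedLadder

/-! ### The statements (verbatim from the registered skeleton `sparse-ladder`) -/

/-- the rung **R10-B** (route item `NegLimited.NeglimitedInverseLinearNegations`, verbatim): one NP
language whose (monotone) slices beat size `n^c` against `⌊log₂ n⌋/(48c+78)` negation gates, for every
`c`, infinitely often — the inverse-linear rate. -/
def NeglimitedInverseLinearNegations : Prop :=
  ∃ L ∈ Literature.Computability.Complexity.Nondeterministic.NP, ∀ c : ℕ, ∃ᶠ n : ℕ in Filter.atTop,
    Monotone (L.sliceFn n) ∧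
      n ^ c < Literature.Computability.Complexity.negLimitedSizeOver
        Literature.Computability.Complexity.deMorganBasis (Nat.log 2 n / (48 * c + 78)) (L.sliceFn n)

/-- stub 4 target `TradeoffGivesRung` (verbatim; packaged as one `Prop` so that exactly one theorem of the
skeleton — the composition — concludes the rung): the engine-level trade-off gives the language-level rung. -/
def TradeoffGivesRung : Prop :=
  NeglimitedCliqueSparseTradeoff → NeglimitedInverseLinearNegations

/-! ### Arithmetic at the lengths `n = m·m + k` -/

/-- `⌊log₂ (m·m + k)⌋ ≤ 2 ⌊log₂ m⌋ + 1` for `k ≤ 2m` (as `m·m + k < (m+1)² ≤ 2^{2⌊log₂ m⌋ + 2}`). -/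
theorem log_sq_add_le {m k : ℕ} (hk : k ≤ 2 * m) : Nat.log 2 (m * m + k) ≤ 2 * Nat.log 2 m + 1 := by
  rcases Nat.eq_zero_or_pos m with rfl | hm
  · have : k = 0 := by omega
    subst this
    simp
  have hlt : m < 2 ^ (Nat.log 2 m + 1) := Nat.lt_pow_succ_log_self one_lt_two m
  have h1 : m + 1 ≤ 2 ^ (Nat.log 2 m + 1) := hlt
  have h2 : m * m + k < 2 ^ (2 * Nat.log 2 m + 2) := by
    calc m * m + k < (m + 1) * (m + 1) := by nlinarith
      _ ≤ 2 ^ (Nat.log 2 m + 1) * 2 ^ (Nat.log 2 m + 1) := Nat.mul_le_mul h1 h1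
      _ = 2 ^ (2 * Nat.log 2 m + 2) := by rw [← pow_add]; ring_nf
  have h := (Nat.log_lt_iff_lt_pow one_lt_two (by positivity)).2 h2
  omega

/-- The NOT budget at length `m·m + k` (`k ≤ 2m`): `⌊log₂(m·m+k)⌋/(48c+78) ≤ ⌊log₂ m⌋/(16c+26)`
(from `3 B (16c+26) ≤ 2 ⌊log₂ m⌋ + 1`). -/
theorem rung_budget_le {m k c : ℕ} (hk : k ≤ 2 * m) :
    Nat.log 2 (m * m + k) / (48 * c + 78) ≤ Nat.log 2 m / (8 * (2 * c + 1) + 18) := by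
  have hpos : 0 < 8 * (2 * c + 1) + 18 := by omega
  set B := Nat.log 2 (m * m + k) / (48 * c + 78) with hB
  have h1 : B * (48 * c + 78) ≤ Nat.log 2 (m * m + k) := Nat.div_mul_le_self _ _
  have h2 : B * (48 * c + 78) ≤ 2 * Nat.log 2 m + 1 := h1.trans (log_sq_add_le hk)
  have h3 : B * (8 * (2 * c + 1) + 18) ≤ Nat.log 2 m := by
    have : 3 * (B * (8 * (2 * c + 1) + 18)) = B * (48 * c + 78) := by ring
    omega
  exact (Nat.le_div_iff_mul_le hpos).2 h3

/-- The size comparison at length `m·m + k`: `(m·m + k)^c + 1 ≤ m^{2c+1}` for `k < m`, `2 ≤ m`, `2^c ≤ m`. -/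
theorem rung_pow_bound {m k c : ℕ} (hm : 2 ≤ m) (h2c : 2 ^ c ≤ m) (hk : k < m) :
    (m * m + k) ^ c + 1 ≤ m ^ (2 * c + 1) := by
  rcases Nat.eq_zero_or_pos c with rfl | hc
  · simpa using hm
  have h1 : (m * m + k) ^ c + 1 ≤ (m * m + k + 1) ^ c := by
    have : (m * m + k) ^ c < (m * m + k + 1) ^ c := Nat.pow_lt_pow_left (by omega) hc.ne'
    omega
  have h2 : m * m + k + 1 ≤ 2 * (m * m) := by nlinarith
  calc (m * m + k) ^ c + 1 ≤ (m * m + k + 1) ^ c := h1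
    _ ≤ (2 * (m * m)) ^ c := Nat.pow_le_pow_left h2 c
    _ = 2 ^ c * (m ^ 2) ^ c := by rw [mul_pow, sq]
    _ ≤ m * (m ^ 2) ^ c := Nat.mul_le_mul_right _ h2c
    _ = m ^ (2 * c + 1) := by rw [← pow_mul, ← pow_succ']

/-! ### The stub -/

/-- **Stub `stub_inverseLinearAssembly` of line `sparse-ladder` PROVED** (`TradeoffGivesRung`, by name):
the trade-off at `c' = 2c+1` (clique size `16c+25`) read through the recurring padded clique language
`recCliqueLang` at the lengths `m·m + (16c+25)` for all large `m`. -/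
theorem stub_inverseLinearAssembly : TradeoffGivesRung := by
  intro hT
  refine ⟨recCliqueLang, recCliqueLang_mem_NP, fun c => ?_⟩
  -- the engine at `c' = 2c + 1`, clique size `k = 8c' + 17 = 16c + 25`, beyond `m₁`
  obtain ⟨m₁, hm₁⟩ := eventually_atTop.1 (hT (2 * c + 1))
  rw [frequently_atTop]
  intro n₀
  -- a length `n = m·m + k` beyond everything
  obtain ⟨m, hmm₁, hmn₀, hkm, h2c⟩ : ∃ m : ℕ, m₁ ≤ m ∧ n₀ ≤ m ∧ 8 * (2 * c + 1) + 17 < m ∧ 2 ^ c ≤ m :=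
    ⟨max (max m₁ n₀) (max (8 * (2 * c + 1) + 18) (2 ^ c)),
      le_trans (le_max_left _ _) (le_max_left _ _), le_trans (le_max_right _ _) (le_max_left _ _),
      Nat.lt_of_lt_of_le (Nat.lt_succ_self _) (le_trans (le_max_left _ _) (le_max_right _ _)),
      le_trans (le_max_right _ _) (le_max_right _ _)⟩
  have hm2 : 2 ≤ m := by omega
  refine ⟨m * m + (8 * (2 * c + 1) + 17), hmn₀.trans ((Nat.le_mul_self m).trans (Nat.le_add_right _ _)),
    monotone_sliceFn_recCliqueLang (by omega) hkm, ?_⟩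
  -- the budget and the size at this length
  have hbudget := rung_budget_le (c := c) (m := m) (k := 8 * (2 * c + 1) + 17) (by omega)
  have hbig : ∀ D : Circuit ↥(⊤ : SimpleGraph (Fin m)).edgeSet, D.IsOver deMorganBasis →
      D.Computes (cliqueFn m (8 * (2 * c + 1) + 17)) →
      D.negationCount ≤ Nat.log 2 (m * m + (8 * (2 * c + 1) + 17)) / (48 * c + 78) →
      (m * m + (8 * (2 * c + 1) + 17)) ^ c + 1 ≤ D.size := by
    intro D hD hcomp hneg
    have h1 := hm₁ m hmm₁ D hD hcomp (hneg.trans hbudget)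
    have h2 := rung_pow_bound (c := c) hm2 h2c hkm
    omega
  have h := le_negLimitedSizeOver_sliceFn_recClique (by omega) hkm hbig
  omega

/-- **THE RUNG `NeglimitedInverseLinearNegations` (R10-B) PROVED** against the verbatim local copy of the
item signature (stmt-PneNP-19681): the registered composition of line `sparse-ladder`
(`neglimitedInverseLinearNegations_via_sparseLadder`) with all four stubs landed —
`stub_inverseLinearAssembly (stub_sparseTradeoffAssembly stub_sparseRelativePow stub_sparseLadderAdvantage)`,
i.e. `stub_inverseLinearAssembly neglimitedCliqueSparseTradeoff_holds`. -/
theorem neglimitedInverseLinearNegations_holds : NeglimitedInverseLinearNegations :=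
  stub_inverseLinearAssembly neglimitedCliqueSparseTradeoff_holds

end Summit.PneNP.PneNP.Theorems.NegLimitedSparseLadder
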